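import Summits.Ventures.MM22.Rank234.RealizeCheck
import Mathlib.Tactic.Ring
import HarnessLib

/-!
# Cell pub-mm22 — splitting a `RealizeCheck` branch node over its listed children (theorems only)

HONEST FRAMING (seat p3 g6): checker PLUMBING, no bound, no result, no new definition. `RNode.check` on a `B`
node with hundreds of children is one kernel `decide` too large for the gate (measured: 510 children ⇒ «(kernel)
excessive memory consumption» after 1,371 s); these lemmas let the replay be established child-list chunk by chunk
(each chunk its own small `decide` of a `List.all`) plus a cheap coverage check, in the spirit of `GF2FastKids` for
the substitution sweeps. Soundness is untouched: the conclusion is the same `check = true` that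
`RealizeSound.notRealizable_of_check` consumes.
-/

namespace Summit.Ventures.MM22.GF2Cert.Realize

open Summit.MatrixMultiplication.OmegaCensus.GF2RankLB

/-- `List.all` from its values on `c` consecutive chunks of length `k` covering the list. -/
theorem list_all_of_chunks {α : Type*} (p : α → Bool) (L : List α) (k c : ℕ) (hlen : L.length ≤ k * c)
    (h : ∀ j, j < c → ((L.drop (k * j)).take k).all p = true) : L.all p = true := by
  induction c generalizing L with
  | zero =>
    have hL : L = [] := List.eq_nil_of_length_eq_zero (by simpa using hlen)
    subst hL
    rfl
  | succ c ih =>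
    rw [← List.take_append_drop k L, List.all_append, Bool.and_eq_true]
    refine ⟨by simpa using h 0 (by omega), ?_⟩
    have e : k * (c + 1) = k * c + k := by ring
    refine ih (L.drop k) (by rw [List.length_drop]; omega) fun j hj => ?_
    have hj1 := h (j + 1) (by omega)
    have e1 : (L.drop k).drop (k * j) = L.drop (k * (j + 1)) := by
      rw [List.drop_drop]
      congr 1
      ring
    rw [e1]
    exact hj1

variable {l m n : ℕ} {K ph : List ℕ} {W : ℕ}

/-- **Branch node from its child list.** `hkids`: every listed child `(c, t)` has `c < W` and passes the replay at
`σ ++ [(g, c)]` (a `List.all`, chunkable by `list_all_of_chunks` / `List.all_append`); `hcov`: every admissible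
output value of class `g` is `0`, excluded by a tight functional, or a listed key. -/
theorem RNode.check_B_of_kids (g : ℕ) (nc : NodeCert) (L : List (ℕ × RNode W)) (σ : List (ℕ × ℕ))
    (hcnt : ph.count g = 1) (hna : assigned σ g = false) (hok : nc.ok l m n K ph σ g = true)
    (hkids : L.all (fun e => decide (e.1 < W) && e.2.check l m n K ph (σ ++ [(g, e.1)])) = true)
    (hcov : (allXors nc.Z).all (fun c => decide (c = 0) || (nc.Ls.any fun Lc => Lc.aExcludes l m n σ g c) ||
      (L.map Prod.fst).elem c) = true) :
    (RNode.B g nc (kidsOf L)).check l m n K ph σ = true := by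
  rw [List.all_eq_true] at hkids hcov
  simp only [RNode.check, hcnt, decide_true, hna, Bool.not_false, hok, Bool.true_and]
  rw [List.all_eq_true]
  intro c hc
  have hcc := hcov c hc
  rcases Bool.eq_false_or_eq_true (decide (c = 0) || nc.Ls.any fun Lc => Lc.aExcludes l m n σ g c) with hA | hA
  · rw [hA, Bool.true_or]
  · rw [hA, Bool.false_or] at hcc ⊢
    obtain ⟨e, he, hec⟩ := List.mem_map.1 (List.mem_of_elem_eq_true hcc)
    cases hf : L.find? (fun e => e.1 == c) with
    | none =>
      have := List.find?_eq_none.1 hf e he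
      rw [hec] at this
      simp at this
    | some e' =>
      have h1 : e'.1 = c := by simpa using List.find?_some hf
      have h2 : e' ∈ L := List.mem_of_find?_eq_some hf
      have hke := hkids e' h2
      rw [Bool.and_eq_true, decide_eq_true_eq, h1] at hke
      obtain ⟨hw, hchk⟩ := hke
      rw [dif_pos hw]
      have hk : kidsOf L ⟨c, hw⟩ = e'.2 := by
        simp only [kidsOf, hf]
      rw [hk]
      exact hchk

end Summit.Ventures.MM22.GF2Cert.Realize
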